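import Mathlib.RingTheory.DedekindDomain.Factorization
import Summits.Ventures.HodgeRepro2.T5UnitaryGroupIsometry
import Summits.Ventures.HodgeRepro2.T5StarOfInvolution
import Summits.Ventures.HodgeRepro2.T5AdicCompletionConjugation
import Summits.Ventures.HodgeRepro2.T5InertPlaceCompletionLattice

/-!
# A global Gram matrix is unimodular, and the standard lattice self-dual, at all but finitely many places
(cell pub-hodge-repro2, seat p3)

Tier-5 N3 support (route/T5-N3-route-2.md §N3.10.3, the [A] line «FINITENESS: a global `𝔬_E`-lattice of `V` (of
`W₁₂`) is self-dual at all `v` outside a finite set», behind «`S_bad` is finite and datum-determined» — MVW's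
clauses (u3)/(u4); seat p8's T5-CHECK-N3-p8.md §§26–28 treat the self-dual lattice at ONE inert place). Here the
GLOBAL statement behind the finiteness is put in the kernel, on Mathlib's completions `L_w` of a number field `L`
(the CM field `E` of the lane) at its finite places `w`:
* `finite_setOf_not_isInteger` — a global element `x ∈ L` is integral at all but finitely many `w` (write
  `x = a / b` with `a, b ∈ 𝓞_L`; outside the finitely many `w ∣ (b)` the valuation of `x` is `≤ 1`);
* `finite_setOf_exists_not_isInteger` — the same for every entry of a matrix at once;
* `badSet H` — THE BAD SET of a matrix `H` over `L`: the places where some entry of `H` or of `H⁻¹` is not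
  integral; **`badSet_finite`**; `eventually_notMem_badSet` (cofinitely many `w` are good);
* **`dualLattice_stdLattice_eq_of_notMem_badSet`** — at every good place, for any star on `L_w` preserving
  integrality, the standard lattice `𝒪_w^n` is SELF-DUAL for `H` (seat p8's `dualLattice` / `stdLattice`,
  T5-128's `dualLattice_stdLattice_eq_self` applied to `H` and `H⁻¹` read in `L_w`);
* **`dualLattice_stdLattice_eq_adicCompletion`** — the same with seat p8's star of the N3 lane at a non-split
  place (`starRingOfQuadratic h2 σ hσ`, `star = σ` for a non-trivial `σ ∈ Gal(L_w/K_v)`): the local conjugation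
  preserves `𝒪_{L_w}` (seat p4's `apply_mem_adicCompletionIntegers`), so every good `w` is self-dual in the
  lane's own spelling (`…_integralClosure` for `𝒪_{E_v} = integralClosure O_{K_v} L_w`, T5-150's equations);
* **`finite_setOf_exists_liesOver_mem_badSet`** — the set of places `v` of the base field `K` under a bad place
  of `L` is finite: outside it EVERY `w ∣ v` is good, which is the shape of the [A] line (the `S_bad` of the
  datum is contained in {ramified} ∪ {p = 2} ∪ {bad for `V`} ∪ {bad for `W₁₂`} ∪ {(u2) fails}, the first two
  finite by seat p8's census (T5-181) and `Ideal.finite_factors`; (u2), the conductor of `ψ`, is not touched here).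
No hypothesis on `L` beyond «number field»; `det H ≠ 0` (as `IsUnit H.det`) is the only hypothesis on `H`.

Mathlib + seat p8's T5-125 (T5StarOfInvolution) / T5-128 (T5UnitaryGroupIsometry) / T5-150
(T5InertPlaceCompletionLattice) + seat p4's T5AdicCompletionConjugation and their imports; no display; no device.
§8(d): uses an L-value-free non-vanishing device: NO.
-/

namespace Summit.Ventures.HodgeRepro2.T5GlobalLatticeAlmostAll

open IsDedekindDomain IsDedekindDomain.HeightOneSpectrum NumberField Matrix
open Summit.Ventures.HodgeRepro2.T5UnitaryGroupIsometry Summit.Ventures.HodgeRepro2.T5StarOfInvolution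
  Summit.Ventures.HodgeRepro2.T5InertPlaceCompletionLattice

/-! ## Integrality at all but finitely many places -/

section Integrality

variable {L : Type*} [Field L] [NumberField L]

/-- A global element `x ∈ L` is integral at all but finitely many finite places: writing `x = a / b` with
`a, b ∈ 𝓞_L`, `b ≠ 0`, the places where `x` is not integral divide `(b)`. -/
theorem finite_setOf_not_isInteger (x : L) :
    {w : HeightOneSpectrum (𝓞 L) | ¬ IsLocalization.IsInteger (w.adicCompletionIntegers L)
      (algebraMap L (w.adicCompletion L) x)}.Finite := by
  obtain ⟨a, b, hb, rfl⟩ := IsFractionRing.div_surjective (𝓞 L) x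
  have hb0 : b ≠ 0 := nonZeroDivisors.ne_zero hb
  refine (Ideal.finite_factors (I := Ideal.span {b})
    (by rw [Ne, Submodule.zero_eq_bot, Ideal.span_singleton_eq_bot]; exact hb0)).subset ?_
  intro w hw
  simp only [Set.mem_setOf_eq] at hw ⊢
  rw [Ideal.dvd_span_singleton]
  by_contra hbw
  apply hw
  refine ⟨⟨_, ?_⟩, rfl⟩
  change ((algebraMap (𝓞 L) L a / algebraMap (𝓞 L) L b : L) : w.adicCompletion L) ∈ w.adicCompletionIntegers L
  rw [mem_adicCompletionIntegers (𝓞 L) L w, valuedAdicCompletion_eq_valuation' w, map_div₀,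
    (valuation_eq_one_iff_notMem w).mpr hbw, div_one]
  exact valuation_le_one w a

/-- Every entry of a matrix over `L` is integral at all but finitely many finite places. -/
theorem finite_setOf_exists_not_isInteger {ι : Type*} [Fintype ι] (M : Matrix ι ι L) :
    {w : HeightOneSpectrum (𝓞 L) | ∃ i j, ¬ IsLocalization.IsInteger (w.adicCompletionIntegers L)
      (algebraMap L (w.adicCompletion L) (M i j))}.Finite := by
  have h : {w : HeightOneSpectrum (𝓞 L) | ∃ i j, ¬ IsLocalization.IsInteger (w.adicCompletionIntegers L)
      (algebraMap L (w.adicCompletion L) (M i j))} =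
      ⋃ i, ⋃ j, {w : HeightOneSpectrum (𝓞 L) | ¬ IsLocalization.IsInteger (w.adicCompletionIntegers L)
        (algebraMap L (w.adicCompletion L) (M i j))} := by
    ext w
    simp only [Set.mem_setOf_eq, Set.mem_iUnion]
  rw [h]
  exact Set.finite_iUnion fun i => Set.finite_iUnion fun j => finite_setOf_not_isInteger (M i j)

end Integrality

/-! ## The bad set of a matrix -/

section BadSet

variable {L : Type*} [Field L] [NumberField L] {ι : Type*} [Fintype ι] [DecidableEq ι]

/-- **THE BAD SET** of a square matrix `H` over the number field `L`: the finite places `w` at which some entry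
of `H` or of `H⁻¹` (Mathlib's `Matrix.inv`, the adjugate divided by the determinant) is not integral. -/
def badSet (H : Matrix ι ι L) : Set (HeightOneSpectrum (𝓞 L)) :=
  {w | ∃ i j, ¬ IsLocalization.IsInteger (w.adicCompletionIntegers L)
      (algebraMap L (w.adicCompletion L) (H i j)) ∨
    ¬ IsLocalization.IsInteger (w.adicCompletionIntegers L) (algebraMap L (w.adicCompletion L) (H⁻¹ i j))}

/-- **The bad set of a matrix is finite.** -/
theorem badSet_finite (H : Matrix ι ι L) : (badSet H).Finite := by
  refine ((finite_setOf_exists_not_isInteger H).union (finite_setOf_exists_not_isInteger H⁻¹)).subset ?_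
  rintro w ⟨i, j, h | h⟩
  · exact Or.inl ⟨i, j, h⟩
  · exact Or.inr ⟨i, j, h⟩

/-- All but finitely many places are good for `H`. -/
theorem eventually_notMem_badSet (H : Matrix ι ι L) :
    ∀ᶠ w : HeightOneSpectrum (𝓞 L) in Filter.cofinite, w ∉ badSet H :=
  Filter.eventually_cofinite.mpr ((badSet_finite H).subset fun _ hw => not_not.mp hw)

/-- At a good place every entry of `H` is integral. -/
theorem isInteger_of_notMem_badSet {H : Matrix ι ι L} {w : HeightOneSpectrum (𝓞 L)} (hw : w ∉ badSet H)
    (i j : ι) :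
    IsLocalization.IsInteger (w.adicCompletionIntegers L) (algebraMap L (w.adicCompletion L) (H i j)) := by
  by_contra h
  exact hw ⟨i, j, Or.inl h⟩

/-- At a good place every entry of `H⁻¹` is integral. -/
theorem isInteger_inv_of_notMem_badSet {H : Matrix ι ι L} {w : HeightOneSpectrum (𝓞 L)} (hw : w ∉ badSet H)
    (i j : ι) :
    IsLocalization.IsInteger (w.adicCompletionIntegers L) (algebraMap L (w.adicCompletion L) (H⁻¹ i j)) := by
  by_contra h
  exact hw ⟨i, j, Or.inr h⟩

/-- `H` and `H⁻¹` read in `L_w` are inverse to each other. -/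
theorem map_mul_map_inv_eq_one {H : Matrix ι ι L} (hdet : IsUnit H.det) (w : HeightOneSpectrum (𝓞 L)) :
    H.map (algebraMap L (w.adicCompletion L)) * H⁻¹.map (algebraMap L (w.adicCompletion L)) = 1 := by
  rw [← Matrix.map_mul, Matrix.mul_nonsing_inv H hdet]
  exact Matrix.map_one _ (map_zero _) (map_one _)

/-- **THE STANDARD LATTICE IS SELF-DUAL AT EVERY GOOD PLACE**, for any star on `L_w` preserving integrality
(seat p8's `dualLattice` / `stdLattice`; `dualLattice_stdLattice_eq_self` on `H` and `H⁻¹` read in `L_w`). -/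
theorem dualLattice_stdLattice_eq_of_notMem_badSet (w : HeightOneSpectrum (𝓞 L)) [StarRing (w.adicCompletion L)]
    (hstar : ∀ x : w.adicCompletion L, IsLocalization.IsInteger (w.adicCompletionIntegers L) x →
      IsLocalization.IsInteger (w.adicCompletionIntegers L) (star x))
    {H : Matrix ι ι L} (hdet : IsUnit H.det) (hw : w ∉ badSet H) :
    dualLattice (w.adicCompletionIntegers L) (H.map (algebraMap L (w.adicCompletion L)))
        (stdLattice (w.adicCompletionIntegers L)) =
      stdLattice (w.adicCompletionIntegers L) :=
  dualLattice_stdLattice_eq_self hstar (map_mul_map_inv_eq_one hdet w)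
    (fun i j => by simpa only [Matrix.map_apply] using isInteger_of_notMem_badSet hw i j)
    (fun i j => by simpa only [Matrix.map_apply] using isInteger_inv_of_notMem_badSet hw i j)

end BadSet

/-! ## With the N3 lane's star at a non-split place, and the places of the base field -/

section Local

variable {K : Type*} [Field K] [NumberField K] (v : HeightOneSpectrum (𝓞 K))
  {L : Type*} [Field L] [NumberField L] [Algebra K L] (w : HeightOneSpectrum (𝓞 L)) [w.asIdeal.LiesOver v.asIdeal]
variable {ι : Type*} [Fintype ι] [DecidableEq ι]

/-- Seat p8's star `starRingOfQuadratic h2 σ hσ` (`star = σ`, a non-trivial `σ ∈ Gal(L_w/K_v)`) preserves the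
integers of `L_w` (seat p4's `apply_mem_adicCompletionIntegers`). -/
theorem isInteger_star_starRingOfQuadratic (h2 : Module.finrank (v.adicCompletion K) (w.adicCompletion L) = 2)
    (σ : (w.adicCompletion L) ≃ₐ[v.adicCompletion K] (w.adicCompletion L)) (hσ : σ ≠ 1)
    (x : w.adicCompletion L) (hx : IsLocalization.IsInteger (w.adicCompletionIntegers L) x) :
    letI := starRingOfQuadratic h2 σ hσ
    IsLocalization.IsInteger (w.adicCompletionIntegers L) (star x) := by
  letI := starRingOfQuadratic h2 σ hσ
  obtain ⟨r, rfl⟩ := hx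
  refine ⟨⟨σ r, T5AdicCompletionConjugation.apply_mem_adicCompletionIntegers v w σ r.2⟩, ?_⟩
  exact (star_eq σ.toRingEquiv _ _).symm

/-- **THE STANDARD LATTICE IS SELF-DUAL AT EVERY GOOD PLACE, IN THE N3 LANE'S VOCABULARY**: at a non-split
place `w ∣ v` (`[L_w : K_v] = 2`, `σ ≠ 1` in `Gal(L_w/K_v)`, seat p8's star `starRingOfQuadratic h2 σ hσ`),
for every `H` over `L` with `det H ≠ 0` and every `w ∉ badSet H`, `𝒪_{L_w}^n` is self-dual for `H`. -/
theorem dualLattice_stdLattice_eq_adicCompletion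
    (h2 : Module.finrank (v.adicCompletion K) (w.adicCompletion L) = 2)
    (σ : (w.adicCompletion L) ≃ₐ[v.adicCompletion K] (w.adicCompletion L)) (hσ : σ ≠ 1)
    {H : Matrix ι ι L} (hdet : IsUnit H.det) (hw : w ∉ badSet H) :
    letI := starRingOfQuadratic h2 σ hσ
    dualLattice (w.adicCompletionIntegers L) (H.map (algebraMap L (w.adicCompletion L)))
        (stdLattice (w.adicCompletionIntegers L)) =
      stdLattice (w.adicCompletionIntegers L) := by
  letI := starRingOfQuadratic h2 σ hσ
  exact dualLattice_stdLattice_eq_of_notMem_badSet w (isInteger_star_starRingOfQuadratic v w h2 σ hσ) hdet hw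

/-- The same with the integers of `L_w` spelled as the lane spells `𝒪_{E_v}`: `integralClosure O_{K_v} L_w`
(seat p8's T5-150 equations `dualLattice_integralClosure_eq` / `stdLattice_integralClosure_eq`, on seat p4's
instance `IsIntegralClosure O_{L_w} O_{K_v} L_w`). -/
theorem dualLattice_stdLattice_eq_adicCompletion_integralClosure
    (h2 : Module.finrank (v.adicCompletion K) (w.adicCompletion L) = 2)
    (σ : (w.adicCompletion L) ≃ₐ[v.adicCompletion K] (w.adicCompletion L)) (hσ : σ ≠ 1)
    {H : Matrix ι ι L} (hdet : IsUnit H.det) (hw : w ∉ badSet H) :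
    letI := starRingOfQuadratic h2 σ hσ
    dualLattice (integralClosure (v.adicCompletionIntegers K) (w.adicCompletion L))
        (H.map (algebraMap L (w.adicCompletion L)))
        (stdLattice (integralClosure (v.adicCompletionIntegers K) (w.adicCompletion L))) =
      stdLattice (integralClosure (v.adicCompletionIntegers K) (w.adicCompletion L)) := by
  letI := starRingOfQuadratic h2 σ hσ
  rw [dualLattice_integralClosure_eq (A := w.adicCompletionIntegers L),
    stdLattice_integralClosure_eq (A := w.adicCompletionIntegers L)]
  exact dualLattice_stdLattice_eq_adicCompletion v w h2 σ hσ hdet hw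

end Local

/-! ## The places of the base field under a bad place -/

section Base

variable {K : Type*} [Field K] {L : Type*} [Field L] [NumberField L] [Algebra K L]
variable {ι : Type*} [Fintype ι] [DecidableEq ι]

/-- **THE PLACES OF THE BASE FIELD UNDER A BAD PLACE FORM A FINITE SET**: outside it, every `w ∣ v` is good for
`H` — the shape of the lane's «self-dual at all `v` outside a finite set». -/
theorem finite_setOf_exists_liesOver_mem_badSet (H : Matrix ι ι L) :
    {v : HeightOneSpectrum (𝓞 K) | ∃ w : HeightOneSpectrum (𝓞 L), w ∈ badSet H ∧
      w.asIdeal.LiesOver v.asIdeal}.Finite := by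
  refine (((badSet_finite H).image fun w : HeightOneSpectrum (𝓞 L) => w.asIdeal.under (𝓞 K)).preimage
    (Function.Injective.injOn (f := fun v : HeightOneSpectrum (𝓞 K) => v.asIdeal)
      fun a b h => HeightOneSpectrum.ext h)).subset ?_
  rintro v ⟨w, hw, hwv⟩
  exact ⟨w, hw, hwv.over.symm⟩

/-- Outside a finite set of places `v` of the base field, every `w ∣ v` is good for each of two matrices (the
Gram matrices of `V` and of `W₁₂` in the lane). -/
theorem finite_setOf_exists_liesOver_mem_badSet_or (H H' : Matrix ι ι L) :
    {v : HeightOneSpectrum (𝓞 K) | ∃ w : HeightOneSpectrum (𝓞 L), (w ∈ badSet H ∨ w ∈ badSet H') ∧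
      w.asIdeal.LiesOver v.asIdeal}.Finite := by
  refine ((finite_setOf_exists_liesOver_mem_badSet (K := K) H).union
    (finite_setOf_exists_liesOver_mem_badSet (K := K) H')).subset ?_
  rintro v ⟨w, h | h, hwv⟩
  · exact Or.inl ⟨w, h, hwv⟩
  · exact Or.inr ⟨w, h, hwv⟩

end Base

end Summit.Ventures.HodgeRepro2.T5GlobalLatticeAlmostAll
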